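import Mathlib
import Literature.NumberTheory.LFunctions.WeilTwoPrimeOddMarginHCert
import Literature.NumberTheory.LFunctions.WeilTwoPrimeQuadratic
import Summits.RiemannHypothesis.RiemannHypothesis.Theses.WeilGroundState
import HarnessLib

/-!
# The `{2,3}`-window ladder: the certified odd-sector bound at window `log 2` (L-side of the last cell `H = [2/3, log 2]`)

Support file (`--supports stmt-RiemannHypothesis-18085`; cruxes `NoParityCrossing` 18085 / `GroundStateSimpleEven` 1526 /
`EvenWinsBeyondArch` 15432 = GroundBarta rung 4, 18807): every `L²`-normalised ODD Weil test function supported in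
`[-log 2, log 2]` has `Re Q(g) ≥ 1/10000000000` — the L-side of the cell `H = [2/3, log 2]` of the cell transfer, whose U-side is
`trialUpperH : ε(2/3) ≤ 1/100000000000` (landed).  It is the kernel-checked two-prime odd-sector MARGIN certificate
`weilCert23H` (`Literature/NumberTheory/LFunctions/WeilTwoPrimeOddMarginH*.lean`: Yoshida's moment method [Yoshida 1992, Thm 1] in the
two-prime analytic form `E₂₃` with the 328 multi-precision-certified cells of the weight on `[0, 120]` (chain `weilTwoPrimeCellsT120`),
half-length `a₀ = b = 1733/2500 > log 2`, `N = 255`, own Legendre blocks at `nb = 128`, odd block at the lowered Bessel coefficient `κ'`,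
margin `κ − κ' ≥ 10⁻¹⁰`; soundness `WeilCert23.weilTwoPrimeQuadratic_margin_of_cellsOK`), transported to `Re Q` by
`weilQuadratic_re_eq_weilTwoPrimeQuadratic` (support inside `[-log 2, log 2]`).  Template: `…SimpleEvenOddLowerK67.lean`.
-/

noncomputable section

open Set MeasureTheory

-- D-0017: single-problem summit ⇒ namespace `Summit.RiemannHypothesis.RiemannHypothesis.…` by design.
set_option linter.dupNamespace false

namespace Summit.RiemannHypothesis.RiemannHypothesis.Theorems

open Literature.NumberTheory.LFunctions

/-- **Certified odd-sector lower bound at window `log 2`**: every `L²`-normalised odd Weil test function on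
`[-log 2, log 2]` has `Re Q ≥ 1/10000000000` (two-prime odd-sector margin certificate H at `a₀ = 1733/2500 ⊇ log 2`). [folklore] -/
theorem oddLowerH69 : ∀ g : ℝ → ℂ, IsWeilTest g → tsupport g ⊆ Icc (-Real.log 2) (Real.log 2) →
    ∫ x, ‖g x‖ ^ 2 = (1 : ℝ) → (∀ x, g (-x) = -g x) → (1 / 10000000000 : ℝ) ≤ (weilQuadratic g).re := by
  intro g hg hs hn ho
  have hl2 := Real.log_two_lt_d9
  have hsH : tsupport g ⊆ Icc (-(1733 / 2500 : ℝ)) (1733 / 2500) :=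
    hs.trans (Icc_subset_Icc (by norm_num at hl2 ⊢; linarith) (by norm_num at hl2 ⊢; linarith))
  have h := oddMargin_weilCert23H hg hsH ho
  rw [weilQuadratic_re_eq_weilTwoPrimeQuadratic hg hs]
  have hn' : weilNorm2Sq g = 1 := hn
  rw [hn', mul_one] at h
  norm_num at h ⊢
  exact h

end Summit.RiemannHypothesis.RiemannHypothesis.Theorems
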